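import Mathlib
import HarnessLib
import Summits.NavierStokesRegularity.NavierStokesRegularity.Theorems.UnthreadedDoorAntidynamoWallOneInstantFrame
import Summits.NavierStokesRegularity.NavierStokesRegularity.Theorems.UnthreadedDoorAntidynamoWallInstant
import Summits.NavierStokesRegularity.NavierStokesRegularity.Theorems.UnthreadedDoorAntidynamoWallLocalClosers
import Summits.NavierStokesRegularity.NavierStokesRegularity.Theorems.UnthreadedDoorCellFluxAxisFrozen
import Summits.NavierStokesRegularity.NavierStokesRegularity.Theorems.UnthreadedDoorCellFluxKNSSTransfer
import Summits.NavierStokesRegularity.NavierStokesRegularity.Theorems.UnthreadedDoorCellFluxForwardVanishing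
import Summits.NavierStokesRegularity.NavierStokesRegularity.Theorems.TypeILiouvilleTypeIliouvilleLOseenGauge

/-!
# Route `UnthreadedDoor` / `ThreadingFlux`, crux `PoloidalLiouville` (stmt-NavierStokesRegularity-1222), antidynamo v2 skeleton (sha16 `4ebf5683127b`),
# WALL `stub_scalarLiouville`: ★★★ ONE-INSTANT Z — a flat direction of the vorticity at ONE instant (even only on one open set) ⇒ irrotational

Support file (seat leafhand-ns-unthreadeddoor-2 g2, cell decomp-ns), `--supports stmt-NavierStokesRegularity-1222 --as helper`; theorems only.

The g1 repair census listed as its next provable piece «(1) ONE-INSTANT Z: ∀ v ∈ 𝒞, flat direction at ONE instant ⇒ trivial — needs a Literature lemma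
(Galilean-BOOST covariance of the Oseen-mild formulation, absent)».  The boost lemma is in the tree (`Theorems.stub_oseen_const_boost`), and this file
closes the item:

* ★★★ `curl_eq_zero_of_flat_direction_slice` — let `v` be a bounded ancient mild solution (`ν = 1`, the tree's duality class) with measurable slices,
  jointly smooth on `(−∞,0) × ℝ³`, with vorticity tangent to the spheres about `x₀` at all times.  If at ONE instant `t₁ < 0` the vorticity is
  orthogonal to ONE fixed vector `e ≠ 0` everywhere, then `curl v ≡ 0` on `(−∞,0) × ℝ³`.
  PROOF.  Oseen gauge `v(t) = w(t, · − A(t)) + c(t)` (`Theorems.oseen_gauge_of_aestronglyMeasurable`); at `t₁` the slice `w(t₁)` is bounded, smooth,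
  divergence free with curl orthogonal to `e` and to `y − p₀`, `p₀ = x₀ − A(t₁)`, hence `w(t₁) − k` (`k = w(t₁, p₀)`) is axisymmetric WITHOUT swirl about
  the axis through `p₀` straightened by a frame `R` (`CellFlux.exists_isAxisymmetricNoSwirlAbout_sub`); by the ONE-INSTANT FRAME LEMMA
  (`OneInstant.isAxisymmetricNoSwirlAbout_boost_of_slice`: constant Galilean boost + bounded Oseen-mild uniqueness forward + time analyticity backward) the
  boosted representative `w♭(t) = w(t, · + (t − t₁)k) − k` is axisymmetric without swirl about that axis at EVERY `t < 0`; undoing the frame,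
  `v(t) − κ(t)` is axisymmetric without swirl about the PARALLEL axis through `q(t) = p₀ + A(t) + (t − t₁)k`.  Unthreadedness about `x₀` and about `q(t)`
  make `curl v(t) ⊥ q(t) − x₀`; so at each `t` EITHER `curl v(t) ≡ 0` (then `curl v ≡ 0` by the one-instant closer `curl_eq_zero_of_curl_slice_eq_zero`) OR
  `q(t) − x₀` is along the axis (`CellFlux.exists_smul_dir_of_forall_inner_curl`), i.e. `v(t) − κ(t)` is axisymmetric without swirl about the axis
  through `x₀` itself — at every `t < 0`; then axis freezing Z-1b (`CellFlux.axisFrozen`) and the KNSS transfer Z-3 (`CellFlux.knssTransfer`, KNSS 2009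
  Thm 5.2 in a moving frame) give `curl v ≡ 0`.
* ★★★ `curl_eq_zero_of_local_flat_direction_slice` — the same if the vorticity is orthogonal to `e` only on a non-empty OPEN SET at one instant (identity
  theorem in the analytic frame of `CellFlux.unthreadedAnalyticOrIrrotational`, tree `inner_curl_eq_zero_of_eq_zero_on_open`).
* the wall's letters `stubScalarLiouville_of_flat_direction_slice` / `…_of_local_flat_direction_slice`, and `constant_of_…`.

MEANING FOR THE WALL (repair census): every «flat direction / local flat direction at ACCUMULATING times» hypothesis of the g0/g1 sector tables
(`curl_eq_zero_of_flat_direction_farPast`, `curl_eq_zero_of_local_orthogonal_direction_frequently`, (C3) of `stubScalarLiouville_of_core`) is now «at ONE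
instant»: for a non-trivial flow of the wall's class, at NO single time and on NO non-empty open set is the vorticity orthogonal to a fixed non-zero
vector (in particular it is nowhere locally zonal / locally planar-valued, at any instant).

HONEST LABEL: assembly over landed theorems (Oseen gauge, constant boost, one-slice symmetry propagation, slice kinematics, Z-1b, Z-3, one-instant closer);
nothing here proves `stub_scalarLiouville`, `PoloidalLiouville` (1222), or bears on Navier–Stokes regularity; no summit statement is proved (crux 1222 is
INCOMPARABLE with the summit). [folklore] [cite: KochNadirashviliSereginSverak2009, Thm 5.2 and §4 (arXiv:0709.3599 pp. 8–10); LemarieRieusset2016, Thm. 9.12;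
MajdaBertozziCUP2002, §1.2, §2.3.3]
-/

noncomputable section

-- the summit and its single sub-problem share the name (CONVENTIONS §1)
set_option linter.dupNamespace false

open scoped Topology InnerProductSpace RealInnerProductSpace ContDiff
open Filter Set Function Metric MeasureTheory
open Literature.Analysis Literature.Analysis.FluidPDE

namespace Summit.NavierStokesRegularity.NavierStokesRegularity.Theorems.PoloidalLiouville.Antidynamo

open Summit.NavierStokesRegularity.NavierStokesRegularity.Theorems.PoloidalLiouville
  (toroidalPotential exists_norm_curl_le constantOfIrrotational)
open Summit.NavierStokesRegularity.NavierStokesRegularity.Theorems.PoloidalLiouville.NetFlux (E3)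
open Summit.NavierStokesRegularity.NavierStokesRegularity.Theorems.PoloidalLiouville.CellFlux
  (conjAxis IsAxisymmetricNoSwirlAbout conjAxis_apply)

namespace OneInstant

/-! ### Moving the axis point -/

/-- Translating a field together with the axis point does not change the straightened field. [folklore] -/
theorem conjAxis_add_translate (R : E3 ≃ₗᵢ[ℝ] E3) (p d : E3) (u : E3 → E3) :
    conjAxis R (p + d) (fun x => u (x - d)) = conjAxis R p u := by
  funext y
  simp only [conjAxis_apply]
  congr 1
  abel

/-- Translating a field together with the axis point preserves «axisymmetric without swirl about the axis». [folklore] -/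
theorem isAxisymmetricNoSwirlAbout_translate_iff (R : E3 ≃ₗᵢ[ℝ] E3) (p d : E3) (u : E3 → E3) :
    IsAxisymmetricNoSwirlAbout R (p + d) (fun x => u (x - d)) ↔ IsAxisymmetricNoSwirlAbout R p u := by
  unfold IsAxisymmetricNoSwirlAbout
  rw [conjAxis_add_translate]

/-- Vertical translations commute with the rotations about the vertical axis. [folklore] -/
theorem rotZ_sub_smul_single_two (θ μ : ℝ) (y : E3) :
    rotZ θ (y - μ • EuclideanSpace.single 2 (1 : ℝ)) = rotZ θ y - μ • EuclideanSpace.single 2 (1 : ℝ) := by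
  ext i
  fin_cases i <;> simp [rotZ_apply_zero, rotZ_apply_one, rotZ_apply_two]

/-- **Moving the axis point ALONG the axis** preserves «axisymmetric without swirl about the axis»: if `u` is axisymmetric without swirl about the axis
through `p + μ R⁻¹e_z` straightened by `R`, it is so about the (same) axis through `p`. [folklore] -/
theorem isAxisymmetricNoSwirlAbout_of_add_smul_dir {u : E3 → E3} {R : E3 ≃ₗᵢ[ℝ] E3} {p : E3} {μ : ℝ}
    (h : IsAxisymmetricNoSwirlAbout R (p + μ • R.symm (EuclideanSpace.single 2 (1 : ℝ))) u) :
    IsAxisymmetricNoSwirlAbout R p u := by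
  obtain ⟨hax, hsw⟩ := h
  set W : E3 → E3 := conjAxis R (p + μ • R.symm (EuclideanSpace.single 2 (1 : ℝ))) u with hW
  have hrel : conjAxis R p u = fun y => W (y - μ • EuclideanSpace.single 2 (1 : ℝ)) := by
    funext y
    simp only [hW, conjAxis_apply, map_sub, LinearIsometryEquiv.map_smul]
    congr 2
    abel
  refine ⟨fun θ y => ?_, fun y => ?_⟩
  · rw [hrel]
    simp only
    rw [← rotZ_sub_smul_single_two, hax θ]
  · have h0 := hsw (y - μ • EuclideanSpace.single 2 (1 : ℝ))
    rw [hrel]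
    simp only [swirl, PiLp.sub_apply, PiLp.smul_apply, smul_eq_mul, PiLp.single_apply] at h0 ⊢
    simpa using h0

/-! ### ★★★ One-instant Z -/

/-- ★★★ **ONE-INSTANT Z: A FLAT DIRECTION OF THE VORTICITY AT ONE INSTANT ⇒ IRROTATIONAL AT ALL TIMES.**  Let `v` be a bounded ancient mild solution
(`ν = 1`, duality class) with measurable slices, jointly smooth on `(−∞,0) × ℝ³`, whose vorticity is tangent to the spheres about `x₀` at all times.  If
for ONE `t₁ < 0` and ONE vector `e ≠ 0`, `⟪e, curl v(t₁, x)⟫ = 0` for all `x`, then `curl v ≡ 0` on `(−∞,0) × ℝ³` (module docstring for the proof).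
[cite: KochNadirashviliSereginSverak2009, Thm 5.2 and §4 (arXiv:0709.3599 pp. 8–10); LemarieRieusset2016, Thm. 9.12; MajdaBertozziCUP2002, §1.2, §2.3.3] -/
theorem curl_eq_zero_of_flat_direction_slice
    (v : ℝ → EuclideanSpace ℝ (Fin 3) → EuclideanSpace ℝ (Fin 3)) (x₀ : EuclideanSpace ℝ (Fin 3))
    (hB : Literature.Analysis.FluidPDE.IsBoundedAncientMildSolution 1 v)
    (hm : ∀ t < 0, AEStronglyMeasurable (v t) volume)
    (hsm : ContDiffOn ℝ (⊤ : ℕ∞) (Function.uncurry v) (Set.Iio 0 ×ˢ Set.univ))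
    (hun : ∀ t < 0, ∀ x, ⟪x - x₀, curl (v t) x⟫ = 0)
    (h₁ : ∃ t₁ < 0, ∃ e : EuclideanSpace ℝ (Fin 3), e ≠ 0 ∧ ∀ x, ⟪e, curl (v t₁) x⟫ = 0) :
    ∀ t < 0, ∀ x, curl (v t) x = 0 := by
  obtain ⟨t₁, ht₁, e, he, hflat⟩ := h₁
  have hsm' : IsSmoothSpaceTimeOn (Iio 0) v := hsm
  -- ## the Oseen gauge, everywhere
  obtain ⟨w, A, c, -, hwc, ⟨K, hK⟩, hwdiv, hwmild, -, hrep⟩ := Theorems.oseen_gauge_of_aestronglyMeasurable v hB hm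
  have hrep' : ∀ s < 0, ∀ y, v s y = w s (y - A s) + c s :=
    fun s hs y => CellFlux.galilean_rep_everywhere hsm.continuousOn hwc hrep hs y
  have hws : ∀ s < 0, w s = fun y => v s (y + A s) - c s := fun s hs => by
    funext y
    have h := hrep' s hs (y + A s)
    rw [add_sub_cancel_right] at h
    rw [h, add_sub_cancel_right]
  have hw_smooth : ∀ s < 0, ContDiff ℝ (⊤ : ℕ∞) (w s) := fun s hs => by
    rw [hws s hs]
    exact ((hsm'.contDiff_slice hs).comp (contDiff_id.add contDiff_const)).sub contDiff_const
  have hw_curl : ∀ s < 0, ∀ y, curl (w s) y = curl (v s) (y + A s) := fun s hs y => by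
    rw [hws s hs, CellFlux.curl_comp_add_sub_const]
  -- ## the slice at `t₁`: axisymmetric without swirl about `(p₀, R)` up to the constant `k`
  set p₀ : E3 := x₀ - A t₁ with hp₀
  have hw2 : ContDiff ℝ 2 (w t₁) := (hw_smooth t₁ ht₁).of_le (by norm_cast)
  have hw1 : ContDiff ℝ 1 (w t₁) := (hw_smooth t₁ ht₁).of_le (by norm_cast)
  have hwdiv₁ : VectorCalculus.IsDivFree (w t₁) := (hwdiv t₁ ht₁).isDivFree_of_contDiff hw1
  have hperp : ∀ y, ⟪y - p₀, curl (w t₁) y⟫ = 0 := fun y => by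
    rw [hw_curl t₁ ht₁]
    have h := hun t₁ ht₁ (y + A t₁)
    have e1 : y + A t₁ - x₀ = y - p₀ := by rw [hp₀]; abel
    rwa [e1] at h
  have hzon : ∀ y, ⟪e, curl (w t₁) y⟫ = 0 := fun y => by
    rw [hw_curl t₁ ht₁]
    exact hflat _
  obtain ⟨R, hR⟩ := CellFlux.exists_isAxisymmetricNoSwirlAbout_sub hw2 (fun y => hK t₁ ht₁ y) hwdiv₁ he hperp hzon
  set k : E3 := w t₁ p₀ with hk
  -- ## the boosted representative is swirl-free axisymmetric about `(p₀, R)` at every time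
  have hsym := isAxisymmetricNoSwirlAbout_boost_of_slice hwc ⟨K, hK⟩ hwdiv hwmild ht₁ hR
  -- ## back to `v`: at every `t`, `v t − κ t` is swirl-free axisymmetric about the parallel axis through `q t`
  set ez : E3 := EuclideanSpace.single 2 (1 : ℝ) with hez
  set q : ℝ → E3 := fun t => p₀ + (A t + (t - t₁) • k) with hq
  set κ : ℝ → E3 := fun t => k + c t with hκ
  have hvq : ∀ t < 0, IsAxisymmetricNoSwirlAbout R (q t) (fun x => v t x - κ t) := by
    intro t ht
    have e1 : (fun x => v t x - κ t) =
        fun x => (fun t y => w t (y + (t - t₁) • k) - k) t (x - (A t + (t - t₁) • k)) := by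
      funext x
      simp only [hκ]
      rw [hrep' t ht x]
      have e2 : x - (A t + (t - t₁) • k) + (t - t₁) • k = x - A t := by abel
      rw [e2]
      abel
    rw [e1]
    exact (isAxisymmetricNoSwirlAbout_translate_iff R p₀ (A t + (t - t₁) • k) _).2 (hsym t ht)
  -- ## `curl v(t) ⊥ q t − x₀` at every time
  have hd : ∀ t < 0, ∀ x, ⟪q t - x₀, curl (v t) x⟫ = 0 := by
    intro t ht x
    have hv1 : ContDiff ℝ 1 (v t) := (hsm'.contDiff_slice ht).of_le (by norm_cast)
    have hWc : ContDiff ℝ 1 (conjAxis R (q t) fun z => v t z - κ t) := CellFlux.contDiff_conjAxis hv1 R (q t) (κ t)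
    have h2 := CellFlux.inner_curl_eq_zero_of_noSwirl (hvq t ht).1 (hvq t ht).2 hWc (R (x - q t))
    rw [CellFlux.curl_conjAxis_sub_const, LinearIsometryEquiv.symm_apply_apply, sub_add_cancel, inner_smul_right,
      LinearIsometryEquiv.inner_map_map] at h2
    have h3 : ⟪x - q t, curl (v t) x⟫ = 0 := (mul_eq_zero.1 h2).resolve_left (CellFlux.det_ne_zero R)
    have e3 : q t - x₀ = (x - x₀) - (x - q t) := by abel
    rw [e3, inner_sub_left, hun t ht x, h3, sub_zero]
  -- ## case A: an irrotational slice
  by_cases hA : ∃ t < 0, ∀ x, curl (v t) x = 0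
  · exact curl_eq_zero_of_curl_slice_eq_zero v x₀ hB hm hsm hun hA
  -- ## case B: `x₀` lies on the axis at every time ⇒ one swirl-free frame about `x₀` ⇒ Z-1b + Z-3
  have hA' : ∀ t < 0, ∃ x, curl (v t) x ≠ 0 := by
    intro t ht
    by_contra h
    push Not at h
    exact hA ⟨t, ht, h⟩
  have hP : ∀ t < 0, ∃ (R' : E3 ≃ₗᵢ[ℝ] E3) (c' : E3), IsAxisymmetricNoSwirlAbout R' x₀ (fun y => v t y - c') := by
    intro t ht
    obtain ⟨x₁, hx₁⟩ := hA' t ht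
    have hv1 : ContDiff ℝ 1 (v t) := (hsm'.contDiff_slice ht).of_le (by norm_cast)
    obtain ⟨μ, hμ⟩ := CellFlux.exists_smul_dir_of_forall_inner_curl hv1 (hvq t ht).1 (hvq t ht).2 hx₁ (hd t ht)
    refine ⟨R, κ t, isAxisymmetricNoSwirlAbout_of_add_smul_dir (μ := μ) ?_⟩
    have e4 : x₀ + μ • R.symm ez = q t := by rw [← hμ]; abel
    rw [e4]
    exact hvq t ht
  obtain ⟨K', hK'⟩ := exists_norm_curl_le hB hsm
  obtain ⟨T, -, -, hlink⟩ := toroidalPotential v x₀ K' hsm hK' hun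
  exfalso
  obtain ⟨x, hx⟩ := hA' t₁ ht₁
  obtain ⟨R', hR'⟩ := CellFlux.axisFrozen v x₀ T hB hm hsm hlink hP t₁ ht₁ fun t ht => hA' t (lt_of_le_of_lt ht ht₁)
  exact hx (CellFlux.knssTransfer v x₀ hB hm hsm t₁ ht₁ R' hR' t₁ le_rfl x)

/-- ★★★ **… HENCE SLICE-WISE CONSTANT AT ALL TIMES.** [cite: KochNadirashviliSereginSverak2009, Thm 5.2 (arXiv:0709.3599 pp. 9–10)] -/
theorem constant_of_flat_direction_slice
    (v : ℝ → EuclideanSpace ℝ (Fin 3) → EuclideanSpace ℝ (Fin 3)) (x₀ : EuclideanSpace ℝ (Fin 3))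
    (hB : Literature.Analysis.FluidPDE.IsBoundedAncientMildSolution 1 v)
    (hm : ∀ t < 0, AEStronglyMeasurable (v t) volume)
    (hsm : ContDiffOn ℝ (⊤ : ℕ∞) (Function.uncurry v) (Set.Iio 0 ×ˢ Set.univ))
    (hun : ∀ t < 0, ∀ x, ⟪x - x₀, curl (v t) x⟫ = 0)
    (h₁ : ∃ t₁ < 0, ∃ e : EuclideanSpace ℝ (Fin 3), e ≠ 0 ∧ ∀ x, ⟪e, curl (v t₁) x⟫ = 0) :
    ∀ t < 0, ∃ b : EuclideanSpace ℝ (Fin 3), ∀ x, v t x = b :=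
  constantOfIrrotational v hB hsm (curl_eq_zero_of_flat_direction_slice v x₀ hB hm hsm hun h₁)

/-! ### ★★★ A LOCAL flat direction at one instant -/

/-- ★★★ **A FLAT DIRECTION ON ONE OPEN SET AT ONE INSTANT ⇒ IRROTATIONAL AT ALL TIMES.**  Under the hypotheses of `curl_eq_zero_of_flat_direction_slice`,
if for ONE `t₁ < 0`, ONE `e ≠ 0` and ONE non-empty open set `U`, `⟪e, curl v(t₁, x)⟫ = 0` for all `x ∈ U`, then `curl v ≡ 0`: in the analytic frame of
`CellFlux.unthreadedAnalyticOrIrrotational` the orthogonality globalises (`inner_curl_eq_zero_of_eq_zero_on_open`), then the previous theorem.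
[cite: KochNadirashviliSereginSverak2009, Thm 5.2 (arXiv:0709.3599 pp. 9–10); LemarieRieusset2016, Thm. 9.12] -/
theorem curl_eq_zero_of_local_flat_direction_slice
    (v : ℝ → EuclideanSpace ℝ (Fin 3) → EuclideanSpace ℝ (Fin 3)) (x₀ : EuclideanSpace ℝ (Fin 3))
    (hB : Literature.Analysis.FluidPDE.IsBoundedAncientMildSolution 1 v)
    (hm : ∀ t < 0, AEStronglyMeasurable (v t) volume)
    (hsm : ContDiffOn ℝ (⊤ : ℕ∞) (Function.uncurry v) (Set.Iio 0 ×ˢ Set.univ))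
    (hun : ∀ t < 0, ∀ x, ⟪x - x₀, curl (v t) x⟫ = 0)
    (hU : ∃ t₁ < 0, ∃ e : EuclideanSpace ℝ (Fin 3), e ≠ 0 ∧ ∃ U : Set (EuclideanSpace ℝ (Fin 3)), IsOpen U ∧ U.Nonempty ∧
      ∀ x ∈ U, ⟪e, curl (v t₁) x⟫ = 0) :
    ∀ t < 0, ∀ x, curl (v t) x = 0 := by
  obtain ⟨t₁, ht₁, e, he, U, hUo, hUne, hUe⟩ := hU
  obtain ⟨K, hK⟩ := exists_norm_curl_le hB hsm
  obtain ⟨T, -, -, hlink⟩ := toroidalPotential v x₀ K hsm hK hun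
  rcases CellFlux.unthreadedAnalyticOrIrrotational v x₀ T hB hm hsm hlink with hA | hZ
  · exact curl_eq_zero_of_flat_direction_slice v x₀ hB hm hsm hun
      ⟨t₁, ht₁, e, he, inner_curl_eq_zero_of_eq_zero_on_open hA e ht₁ hUo hUne hUe⟩
  · exact hZ

/-- ★★★ **… HENCE SLICE-WISE CONSTANT AT ALL TIMES.** [cite: KochNadirashviliSereginSverak2009, Thm 5.2 (arXiv:0709.3599 pp. 9–10)] -/
theorem constant_of_local_flat_direction_slice
    (v : ℝ → EuclideanSpace ℝ (Fin 3) → EuclideanSpace ℝ (Fin 3)) (x₀ : EuclideanSpace ℝ (Fin 3))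
    (hB : Literature.Analysis.FluidPDE.IsBoundedAncientMildSolution 1 v)
    (hm : ∀ t < 0, AEStronglyMeasurable (v t) volume)
    (hsm : ContDiffOn ℝ (⊤ : ℕ∞) (Function.uncurry v) (Set.Iio 0 ×ˢ Set.univ))
    (hun : ∀ t < 0, ∀ x, ⟪x - x₀, curl (v t) x⟫ = 0)
    (hU : ∃ t₁ < 0, ∃ e : EuclideanSpace ℝ (Fin 3), e ≠ 0 ∧ ∃ U : Set (EuclideanSpace ℝ (Fin 3)), IsOpen U ∧ U.Nonempty ∧
      ∀ x ∈ U, ⟪e, curl (v t₁) x⟫ = 0) :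
    ∀ t < 0, ∃ b : EuclideanSpace ℝ (Fin 3), ∀ x, v t x = b :=
  constantOfIrrotational v hB hsm (curl_eq_zero_of_local_flat_direction_slice v x₀ hB hm hsm hun hU)

/-! ### The wall's letters -/

/-- ★★★ **THE WALL'S LETTER: A FLAT DIRECTION OF `∇T × (x − x₀)` ON ONE OPEN SET AT ONE INSTANT ⇒ TRIVIAL.**  If the vorticity of the wall's flow is
`∇T(t,·) × (· − x₀)` and at ONE `t₁ < 0` it is orthogonal to ONE `e ≠ 0` on ONE non-empty open set, then `∇T × (x − x₀) ≡ 0` on `(−∞,0) × ℝ³`.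
[cite: KochNadirashviliSereginSverak2009, Thm 5.2 (arXiv:0709.3599 pp. 9–10)] -/
theorem stubScalarLiouville_of_local_flat_direction_slice
    (v : ℝ → EuclideanSpace ℝ (Fin 3) → EuclideanSpace ℝ (Fin 3)) (x₀ : EuclideanSpace ℝ (Fin 3))
    (T : ℝ → EuclideanSpace ℝ (Fin 3) → ℝ)
    (hB : Literature.Analysis.FluidPDE.IsBoundedAncientMildSolution 1 v)
    (hm : ∀ t < 0, AEStronglyMeasurable (v t) volume)
    (hsm : ContDiffOn ℝ (⊤ : ℕ∞) (Function.uncurry v) (Set.Iio 0 ×ˢ Set.univ))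
    (hrep : ∀ t < 0, ∀ x, Literature.Analysis.FluidPDE.curl (v t) x =
      Literature.Analysis.FluidPDE.cross (gradient (T t) x) (x - x₀))
    (hU : ∃ t₁ < 0, ∃ e : EuclideanSpace ℝ (Fin 3), e ≠ 0 ∧ ∃ U : Set (EuclideanSpace ℝ (Fin 3)), IsOpen U ∧ U.Nonempty ∧
      ∀ x ∈ U, ⟪e, Literature.Analysis.FluidPDE.cross (gradient (T t₁) x) (x - x₀)⟫ = 0) :
    ∀ t < 0, ∀ x, Literature.Analysis.FluidPDE.cross (gradient (T t) x) (x - x₀) = 0 := by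
  have hun : ∀ t < 0, ∀ x, ⟪x - x₀, curl (v t) x⟫ = 0 := fun t ht x => by
    rw [hrep t ht x]
    simp [cross, crossProduct, PiLp.inner_apply, Fin.sum_univ_three]
    ring
  obtain ⟨t₁, ht₁, e, he, U, hUo, hUne, hUe⟩ := hU
  have hUe' : ∀ x ∈ U, ⟪e, curl (v t₁) x⟫ = 0 := fun x hx => by
    rw [hrep t₁ ht₁ x]
    exact hUe x hx
  intro t ht x
  rw [← hrep t ht x]
  exact curl_eq_zero_of_local_flat_direction_slice v x₀ hB hm hsm hun ⟨t₁, ht₁, e, he, U, hUo, hUne, hUe'⟩ t ht x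

/-- ★★★ **THE WALL'S LETTER: A FLAT DIRECTION AT ONE INSTANT ⇒ TRIVIAL** (everywhere form). [cite: KochNadirashviliSereginSverak2009, Thm 5.2 (arXiv:0709.3599 pp. 9–10)] -/
theorem stubScalarLiouville_of_flat_direction_slice
    (v : ℝ → EuclideanSpace ℝ (Fin 3) → EuclideanSpace ℝ (Fin 3)) (x₀ : EuclideanSpace ℝ (Fin 3))
    (T : ℝ → EuclideanSpace ℝ (Fin 3) → ℝ)
    (hB : Literature.Analysis.FluidPDE.IsBoundedAncientMildSolution 1 v)
    (hm : ∀ t < 0, AEStronglyMeasurable (v t) volume)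
    (hsm : ContDiffOn ℝ (⊤ : ℕ∞) (Function.uncurry v) (Set.Iio 0 ×ˢ Set.univ))
    (hrep : ∀ t < 0, ∀ x, Literature.Analysis.FluidPDE.curl (v t) x =
      Literature.Analysis.FluidPDE.cross (gradient (T t) x) (x - x₀))
    (h₁ : ∃ t₁ < 0, ∃ e : EuclideanSpace ℝ (Fin 3), e ≠ 0 ∧
      ∀ x, ⟪e, Literature.Analysis.FluidPDE.cross (gradient (T t₁) x) (x - x₀)⟫ = 0) :
    ∀ t < 0, ∀ x, Literature.Analysis.FluidPDE.cross (gradient (T t) x) (x - x₀) = 0 := by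
  obtain ⟨t₁, ht₁, e, he, h⟩ := h₁
  exact stubScalarLiouville_of_local_flat_direction_slice v x₀ T hB hm hsm hrep
    ⟨t₁, ht₁, e, he, univ, isOpen_univ, univ_nonempty, fun x _ => h x⟩

end OneInstant

end Summit.NavierStokesRegularity.NavierStokesRegularity.Theorems.PoloidalLiouville.Antidynamo

end
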